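import Mathlib.Analysis.Calculus.MeanValue
import Mathlib.Analysis.Calculus.Deriv.Mul
import Mathlib.Analysis.Calculus.Deriv.Add
import Mathlib.Analysis.Calculus.Deriv.Shift
import Mathlib.Analysis.Calculus.ContDiff.Deriv
import Mathlib.Analysis.SpecialFunctions.Trigonometric.Deriv
import Mathlib.Analysis.Complex.Basic
import Summits.HodgeConjecture.HodgeConjecture.Theorems.K2E4ArchSingularKernelWallStepLemmas   -- ★ p854846: `flat_factor_of_even`
import HarnessLib

/-!
# The calculus of the `G′`-side one-step law of the endoscopic singular transfer at `∞`: a finite sum of «flat factor × jump function» along `ψ → 0+`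
# (Rogawski 1990 Prop. 8.2.1 (a) proof p. 119, §8.2 pp. 122–124)

Cell `pub/hodgecm-mathlib`, Track B «K2-LIT», engine K2·E4, sockets #11 `sig_K2E4ArchSingularKernel` ∕ #9 `sig_K2E4ExplicitArchSingularTransfer` (crux H413 =
`stmt-HodgeConjecture-24833`); brick G3-calc of the V2 «G′ PACKAGE» (K2E4-p11; lands `--supports stmt-HodgeConjecture-24833`).  Pure one-variable calculus, `ℂ`-valued; no measure theory.

WHY.  The `G′`-state of the joint place induction (★ `K2E4ArchSingularKernelPlaceInduction.eq_of_step_of_regular_eq_splitCurve`) at the processed places `S` is a finite sum over the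
relabellings `ρ : W → S₃` of terms `Φ_ρ(u) · I_ρ(u)`: `I_ρ` the orbit-measure state of ★ (R1-e′) (whose one-partner jump along the wall curve at the moving place `w` is ★
`K2E4ArchPartnerWallJumpOrbitMeasure`: `∂_ψ[2 sin ψ · I_ρ(ψ)] → ℓ_ρ` on `𝓝[>] 0`, with differentiability on the window) and `Φ_ρ` the explicit-factor weight `c·N⁻¹·χ·Δ″(γ_H, t(z∘ρ))·Π_{v∈S} κ_v(ρ_v)`,
which along the curve is `a_ρ · σ(ψ)` with ONE smooth EVEN function `σ = τ·D_{G∕H}` [Rogawski1990 p. 119: «`τ(γ)|A₁(γ)A₂(γ)|` … is smooth near `ψ = 0` and its derivative with respect to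
`ψ` vanishes at zero»].  THIS FILE is the calculus that turns these per-partner data into the state's one-step law:
`∂_ψ[2 sin ψ · Σ_ρ a_ρ σ(ψ) I_ρ(ψ)] → Σ_ρ a_ρ σ(0) ℓ_ρ` on `𝓝[>] 0`.
* §1 `exists_forall_norm_le_of_tendsto_deriv_nhdsGT` — a function differentiable on the right window with a derivative limit along `𝓝[>] 0` is BOUNDED there (mean value inequality; this
  is why no one-sided-limit letter is needed for the cross term), `tendsto_deriv_mul_of_flat_of_tendsto_deriv` — the one-sided FLAT-FACTOR product rule (twin of ★
  `K2E4ArchSingularKernelWallStepLemmas.tendsto_deriv_mul_of_tendsto_deriv_factor_zero` with all jump-side hypotheses on the one-sided filter).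
* §2 **`tendsto_deriv_two_sin_mul_sum_flat_mul`** — the summed step above (`deriv Σ = Σ deriv` on the window by `Filter.eventually_all_finset`), and the `•`-spelling adapter
  `two_sin_smul_eq_ofReal_mul` for consumers whose observable is `(2 * Real.sin ψ) • x` (p09's `G`).
HONEST LABEL: HC_CM is proved only modulo the 7 printed citations (2 remaining named inputs: hLiu418 = stmt-HodgeConjecture-24832, h413 = stmt-HodgeConjecture-24833) until rung 0
closes; calculus, pays nothing by itself.

## References
* [Rogawski1990] J. D. Rogawski, *Automorphic Representations of Unitary Groups in Three Variables*, Ann. of Math. Stud. 123 (1990), Prop. 8.2.1 (a) proof p. 119; §8.2 pp. 122–124.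
* [Varadarajan1989] V. S. Varadarajan, *An Introduction to Harmonic Analysis on Semisimple Lie Groups* (1989), §6.4 Thms 18, 22.
-/

set_option autoImplicit false
set_option linter.dupNamespace false  -- the cell's namespace convention `Summit.HodgeConjecture.HodgeConjecture.Cruxes.H413.<File>` repeats the summit = problem name

noncomputable section

open Filter Topology Function Set

namespace Summit.HodgeConjecture.HodgeConjecture.Cruxes.H413.K2E4ArchGStateStepCalculus

/-! ## §1 Boundedness from the one-sided derivative limit; the one-sided flat-factor product rule -/

/-- **BOUNDED ON THE RIGHT WINDOW**: if `F` is differentiable at every point of a right punctured neighbourhood of `0` and `∂F → D` along `𝓝[>] 0`, then `‖F‖` is bounded on a right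
punctured neighbourhood of `0` (mean value inequality on `(0, δ)` from the base point `δ∕2`). [cite: Varadarajan1989, §6.4 Thm. 18] [cite: Rogawski1990, Prop. 8.2.1 (a) proof p. 119] -/
theorem exists_forall_norm_le_of_tendsto_deriv_nhdsGT {F : ℝ → ℂ} {D : ℂ}
    (hd : ∀ᶠ ψ in 𝓝[>] (0 : ℝ), DifferentiableAt ℝ F ψ) (hlim : Tendsto (fun ψ : ℝ => deriv F ψ) (𝓝[>] 0) (𝓝 D)) :
    ∃ M : ℝ, ∀ᶠ ψ in 𝓝[>] (0 : ℝ), ‖F ψ‖ ≤ M := by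
  have hb : ∀ᶠ ψ in 𝓝[>] (0 : ℝ), ‖deriv F ψ‖ ≤ ‖D‖ + 1 :=
    ((hlim.norm).eventually (gt_mem_nhds (lt_add_one ‖D‖))).mono fun ψ hψ => hψ.le
  obtain ⟨δ, hδ, hδb⟩ : ∃ δ > 0, ∀ ψ : ℝ, 0 < ψ → ψ < δ → DifferentiableAt ℝ F ψ ∧ ‖deriv F ψ‖ ≤ ‖D‖ + 1 := by
    have h := hd.and hb
    rw [eventually_nhdsWithin_iff, Metric.eventually_nhds_iff] at h
    obtain ⟨ε, hε, h⟩ := h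
    exact ⟨ε, hε, fun ψ h0 hψ => h (by rw [Real.dist_eq, sub_zero, abs_of_pos h0]; exact hψ) h0⟩
  refine ⟨‖F (δ / 2)‖ + (‖D‖ + 1) * δ, ?_⟩
  have hwin : ∀ᶠ ψ in 𝓝[>] (0 : ℝ), ψ < δ := by
    rw [eventually_nhdsWithin_iff, Metric.eventually_nhds_iff]
    exact ⟨δ, hδ, fun ψ hψ _ => by rw [Real.dist_eq, sub_zero] at hψ; exact lt_of_abs_lt hψ⟩
  filter_upwards [hwin, self_mem_nhdsWithin] with ψ hψδ hψ0
  have hψ0' : 0 < ψ := hψ0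
  have hconv : Convex ℝ (Ioo (0 : ℝ) δ) := convex_Ioo _ _
  have hdiff : ∀ x ∈ Ioo (0 : ℝ) δ, DifferentiableAt ℝ F x := fun x hx => (hδb x hx.1 hx.2).1
  have hbound : ∀ x ∈ Ioo (0 : ℝ) δ, ‖deriv F x‖ ≤ ‖D‖ + 1 := fun x hx => (hδb x hx.1 hx.2).2
  have hx₀ : δ / 2 ∈ Ioo (0 : ℝ) δ := ⟨by linarith, by linarith⟩
  have hmv := hconv.norm_image_sub_le_of_norm_deriv_le hdiff hbound hx₀ ⟨hψ0', hψδ⟩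
  have hdist : ‖ψ - δ / 2‖ ≤ δ := by
    rw [Real.norm_eq_abs, abs_le]; constructor <;> linarith
  have hD : 0 ≤ ‖D‖ + 1 := by positivity
  calc ‖F ψ‖ = ‖F (δ / 2) + (F ψ - F (δ / 2))‖ := by rw [add_sub_cancel]
    _ ≤ ‖F (δ / 2)‖ + ‖F ψ - F (δ / 2)‖ := norm_add_le _ _
    _ ≤ ‖F (δ / 2)‖ + (‖D‖ + 1) * ‖ψ - δ / 2‖ := by linarith [hmv]
    _ ≤ ‖F (δ / 2)‖ + (‖D‖ + 1) * δ := by nlinarith [hdist, hD]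

/-- **THE ONE-SIDED FLAT-FACTOR PRODUCT RULE.**  `σ` differentiable near `0`, continuous at `0`, `σ′ → 0` at `0` (two-sided data: the explicit factor is smooth THROUGH the wall); `h`
differentiable and bounded `l`-eventually with `h′ → D` along a filter `l ≤ 𝓝 0` (the jump function, one-sided data).  Then `(σ·h)′ → σ(0)·D` along `l`.
[cite: Rogawski1990, Prop. 8.2.1 (a) proof p. 119] [cite: Varadarajan1989, §6.4 Thm 22] -/
theorem tendsto_deriv_mul_of_flat_of_tendsto_deriv {l : Filter ℝ} (hl : l ≤ 𝓝 (0 : ℝ)) {σ h : ℝ → ℂ} {D : ℂ} {M : ℝ}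
    (hσd : ∀ᶠ ψ in 𝓝 (0 : ℝ), DifferentiableAt ℝ σ ψ) (hσ0 : ContinuousAt σ 0) (hσ' : Tendsto (deriv σ) (𝓝 0) (𝓝 0))
    (hhd : ∀ᶠ ψ in l, DifferentiableAt ℝ h ψ) (hhb : ∀ᶠ ψ in l, ‖h ψ‖ ≤ M) (hD : Tendsto (fun ψ => deriv h ψ) l (𝓝 D)) :
    Tendsto (fun ψ => deriv (fun ψ => σ ψ * h ψ) ψ) l (𝓝 (σ 0 * D)) := by
  have hev : (fun ψ => deriv (fun ψ => σ ψ * h ψ) ψ) =ᶠ[l] fun ψ => deriv σ ψ * h ψ + σ ψ * deriv h ψ := by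
    filter_upwards [hσd.filter_mono hl, hhd] with ψ hσψ hhψ
    exact (hσψ.hasDerivAt.mul hhψ.hasDerivAt).deriv
  rw [tendsto_congr' hev]
  have h1 : Tendsto (fun ψ => deriv σ ψ * h ψ) l (𝓝 0) :=
    (hσ'.mono_left hl).zero_mul_isBoundedUnder_le (Filter.isBoundedUnder_of_eventually_le hhb)
  have h2 : Tendsto (fun ψ => σ ψ * deriv h ψ) l (𝓝 (σ 0 * D)) := (hσ0.tendsto.mono_left hl).mul hD
  simpa only [zero_add] using h1.add h2

/-! ## §2 The summed step -/

/-- **THE `G′`-STATE ONE-STEP LAW, CALCULUS FORM.**  Finitely many partners `i ∈ s` with jump functions `I_i` such that `ψ ↦ 2 sin ψ · I_i(ψ)` is differentiable on a right punctured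
neighbourhood of `0` with `∂_ψ[2 sin ψ · I_i] → ℓ_i` along `𝓝[>] 0` (★ `K2E4ArchPartnerWallJumpOrbitMeasure`), weights `a_i` and ONE even `C¹` factor `σ` (the explicit factor `τ·D_{G∕H}` along
the curve, shared by all partners).  Then `∂_ψ[2 sin ψ · Σ_{i∈s} (a_i σ(ψ)) · I_i(ψ)] → Σ_{i∈s} a_i σ(0) ℓ_i` along `𝓝[>] 0`.
[cite: Rogawski1990, Prop. 8.2.1 (a) proof p. 119; §8.2 p. 124] [cite: Varadarajan1989, §6.4 Thm 22] -/
theorem tendsto_deriv_two_sin_mul_sum_flat_mul {ι : Type*} (s : Finset ι) (I : ι → ℝ → ℂ) (ℓ : ι → ℂ) (a : ι → ℂ)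
    {σ : ℝ → ℂ} (hσ : ContDiff ℝ 1 σ) (heven : ∀ x, σ (-x) = σ x)
    (hId : ∀ i ∈ s, ∀ᶠ ψ in 𝓝[>] (0 : ℝ), DifferentiableAt ℝ (fun ψ : ℝ => (2 * Real.sin ψ : ℂ) * I i ψ) ψ)
    (hIl : ∀ i ∈ s, Tendsto (fun ψ : ℝ => deriv (fun ψ : ℝ => (2 * Real.sin ψ : ℂ) * I i ψ) ψ) (𝓝[>] 0) (𝓝 (ℓ i))) :
    Tendsto (fun ψ : ℝ => deriv (fun ψ : ℝ => (2 * Real.sin ψ : ℂ) * ∑ i ∈ s, (a i * σ ψ) * I i ψ) ψ) (𝓝[>] 0)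
      (𝓝 (∑ i ∈ s, a i * σ 0 * ℓ i)) := by
  obtain ⟨hσd, hσ0, hσ'⟩ := K2E4ArchSingularKernelWallStepLemmas.flat_factor_of_even hσ heven
  -- the function is the finite sum of `(a_i σ) · (2 sin ψ · I_i)`
  have hfun : (fun ψ : ℝ => (2 * Real.sin ψ : ℂ) * ∑ i ∈ s, (a i * σ ψ) * I i ψ) =
      fun ψ : ℝ => ∑ i ∈ s, (a i * σ ψ) * ((2 * Real.sin ψ : ℂ) * I i ψ) := by
    funext ψ
    rw [Finset.mul_sum]
    exact Finset.sum_congr rfl fun i _ => by ring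
  rw [hfun]
  -- each term: flat factor `a_i σ`, bounded jump function
  have hterm : ∀ i ∈ s, Tendsto (fun ψ : ℝ => deriv (fun ψ : ℝ => (a i * σ ψ) * ((2 * Real.sin ψ : ℂ) * I i ψ)) ψ) (𝓝[>] 0) (𝓝 (a i * σ 0 * ℓ i)) := by
    intro i hi
    obtain ⟨M, hM⟩ := exists_forall_norm_le_of_tendsto_deriv_nhdsGT (hId i hi) (hIl i hi)
    have hσd' : ∀ᶠ ψ in 𝓝 (0 : ℝ), DifferentiableAt ℝ (fun ψ => a i * σ ψ) ψ := hσd.mono fun ψ hψ => hψ.const_mul _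
    have hσ0' : ContinuousAt (fun ψ => a i * σ ψ) 0 := continuousAt_const.mul hσ0
    have hσ'' : Tendsto (deriv (fun ψ => a i * σ ψ)) (𝓝 0) (𝓝 0) := by
      have hev : deriv (fun ψ => a i * σ ψ) =ᶠ[𝓝 (0 : ℝ)] fun ψ => a i * deriv σ ψ := by
        filter_upwards [hσd] with ψ hψ
        exact deriv_const_mul (a i) hψ
      rw [tendsto_congr' hev]
      simpa only [mul_zero] using hσ'.const_mul (a i)
    exact tendsto_deriv_mul_of_flat_of_tendsto_deriv nhdsWithin_le_nhds hσd' hσ0' hσ'' (hId i hi) hM (hIl i hi)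
  -- `deriv Σ = Σ deriv` on the window where every term is differentiable
  have hdiff : ∀ᶠ ψ in 𝓝[>] (0 : ℝ), ∀ i ∈ s, DifferentiableAt ℝ (fun ψ : ℝ => (a i * σ ψ) * ((2 * Real.sin ψ : ℂ) * I i ψ)) ψ := by
    have h : ∀ i ∈ s, ∀ᶠ ψ in 𝓝[>] (0 : ℝ), DifferentiableAt ℝ (fun ψ : ℝ => (a i * σ ψ) * ((2 * Real.sin ψ : ℂ) * I i ψ)) ψ := by
      intro i hi
      filter_upwards [hId i hi, mem_nhdsWithin_of_mem_nhds hσd] with ψ hI hσψ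
      exact (hσψ.const_mul (a i)).mul hI
    exact (Finset.eventually_all s).2 h
  have hev : (fun ψ : ℝ => deriv (fun ψ : ℝ => ∑ i ∈ s, (a i * σ ψ) * ((2 * Real.sin ψ : ℂ) * I i ψ)) ψ) =ᶠ[𝓝[>] (0 : ℝ)]
      fun ψ => ∑ i ∈ s, deriv (fun ψ : ℝ => (a i * σ ψ) * ((2 * Real.sin ψ : ℂ) * I i ψ)) ψ := by
    filter_upwards [hdiff] with ψ hψ
    have hf : (fun ψ : ℝ => ∑ i ∈ s, (a i * σ ψ) * ((2 * Real.sin ψ : ℂ) * I i ψ)) =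
        ∑ i ∈ s, fun ψ : ℝ => (a i * σ ψ) * ((2 * Real.sin ψ : ℂ) * I i ψ) := by
      funext ψ; rw [Finset.sum_apply]
    rw [hf, deriv_sum hψ]
  rw [tendsto_congr' hev]
  exact tendsto_finsetSum s hterm

/-- The `•`-spelling of the observable: `(2 sin ψ) • x = (2 sin ψ : ℂ) · x` on `ℂ` (adapter for consumers whose observable is a real scalar action). [cite: Rogawski1990, §8.2 p. 119] -/
theorem two_sin_smul_eq_ofReal_mul (f : ℝ → ℂ) :
    (fun ψ : ℝ => (2 * Real.sin ψ) • f ψ) = fun ψ : ℝ => (2 * Real.sin ψ : ℂ) * f ψ := by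
  funext ψ
  rw [Complex.real_smul]
  push_cast
  ring

end Summit.HodgeConjecture.HodgeConjecture.Cruxes.H413.K2E4ArchGStateStepCalculus

end
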